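import Mathlib
import HarnessLib
import HarnessLib.Audit
import Summits.KontsevichZagierPeriods.Statement
import HarnessLib.Audit.Status.Attr

/-!
Route: PhiFourHepp

DORMANT since 2026-08-24T14:46:07Z (reconciler: no traction for 6.8 d (last activity item-evidence-added at 2026-08-17T18:10:27Z); parked, not closed — `ledger route dormant route-KontsevichZagierPeriods-PhiFourHepp --off` to reactivate) — unstaffed, not closed; items shared with open routes are served there. `ledger route dormant <id> --off` reactivates.

# Route PhiFourHepp — KZ^H — adjoin "Hepp-equal phi^4 graphs are interderivable"; Feynman's
dictionary compiled to moves certifies the known relators, tropical lifting is the bet, the enlarged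
kernel closes

X = TropicalLifting ∧ PhiFourKernelH ("it suffices to show X"; card phi4-hepp-tropical-lifting;
conforming successor of route
PhiFourLaboratory, retired `not-a-thesis` by the D-0027 audit because its assembly stopped at the
sector target PhiFourSector — here the
deciding theorem `closes : TropicalLifting → PhiFourKernelH → KontsevichZagierPeriods` is PROVED in
the folder's Sketch.lean/glue.lean).
Write KZ^H for the calculus of moves ENLARGED by one relator scheme, decidable on edge lists: [r_E₁]
− [r_E₂] for every pair of φ⁴
graphs (edge lists with 2k+2 edges on k+2 vertices and every degree ≤ 4 — Panzer's definition of "in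
φ⁴", Panzer2022 p. 4) whose
parametric representations r_E = [ℝ₊^(2k+1), 1/Ψ_E(x,1)²] (Ψ_E inlined as det[[diag(x,1),
B],[−Bᵀ,0]] = Σ_T Π_(e∉T) x_e, B the reduced
incidence matrix) have EQUAL HEPP BOUND H(E₁) = H(E₂) ∈ ℚ, the tropicalisation of the period,
inlined by the flag formula (Panzer2022
Prop. 3.2). TropicalLifting (the card's bet, rank 4): every such relator is already a KZ relation —
by soundness this contains Panzer's
Conj. 1.2 (⇐), every duality / completion / twist / Fourier identity as an UNPADDED move chain, and
the unexplained 8-loop pairs.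
PhiFourKernelH (target, stated openly at GPC strength): ker(eval) is generated by the four moves AND
the Hepp relators. The ranked
laboratory cruxes PositionIsParametric (2), CompletionFiveR (3), PositionK4 (5) and the supports are
Feynman's dictionary
(Schnetz2010 §2.2: position ↔ parametric ↔ dual parametric) compiled into rules 1)–3) — the engine
that certifies the known relators.
Lean: `TropicalLifting ∧ PhiFourKernelH`

## Assembly
DECIDING THEOREM (D-0027 §2.1), PROVED in glue.lean / Sketch.lean (rc 0, 0 sorries, 12 lines):
`closes : TropicalLifting → PhiFourKernelH →
KontsevichZagierPeriods` — given rational r, r' with equal value, `[r] − [r']` has `KZ.eval = 0`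
(`KZ.eval_of`, `map_sub`); PhiFourKernelH puts it in
closure(four move sets ∪ S_H); `AddSubgroup.closure_le` with
`KZ.domainAddRel/integrandAddRel/changeOfVariablesRel/newtonLeibnizRel_subset_relations`
and TropicalLifting (which is verbatim `S_H ⊆ KZ.relations` after `rintro ⟨k₁, k₂, E₁, E₂, r₁, r₂,
…, rfl⟩`) gives closure ≤ KZ.relations, i.e.
`KZ.Equivalent r r'`. PositionIsParametric, CompletionFiveR, PositionK4 and the supports are not in
the implication chain: they are the engine
parts by which relators get certified and the record of the logical position (KernelOfSummitR: given
TropicalLifting, PhiFourKernelH ⇔ the summit).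

Rationale: WHY THIS LINE. Imported area: perturbative QFT's φ⁴ period corpus (Schnetz2010 census;
PanzerSchnetz2017: > 1000 exact periods; Balduf2023: ALL periods
numerically for ℓ ≤ 13) and its TROPICAL shadow — the Hepp bound is the tropicalised period, a
rational invariant respecting all five period
symmetries (Panzer2022 Thm 1.1), conjecturally PERFECT on φ⁴ graphs (Conj. 1.2; equal Hepp classes =
equal Martin data M(G^[r]) for all
ℓ ≤ 11, PanzerYeats2025 Table 3, whose Conj. 1.10 refines it and whose p. 9 announces, with F.
Brown, that the period is computable from
the Martin sequence), so that in this sector Kontsevich–Zagier's Problem 1 is conjecturally decided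
by a computable rational number and
Conjecture 1 predicts a move chain behind every Hepp coincidence, including P₈,₃₀/P₈,₃₆ (H =
1724488/3) and P₈,₃₁/P₈,₃₅ (H = 536760),
which no symmetry explains (Panzer2022 §5.2, p. 43; PanzerYeats2025 (7.1)). Mechanism: adjoin
exactly these coincidences as a relator
scheme (KZ^H) so that the enlarged kernel closes the summit by pure logic, and attack the relators
with Feynman's dictionary made
rule-internal — Feynman parameters with RATIONAL Newton–Leibniz primitives, fibrewise algebraic
scalings, π produced from balls by disc
slicing and never integrated, conformal inversion x ↦ x/|x|² for completion, Cremona u = 1/x for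
duality — plus the structural observation
that position space certifies only π^(2k)-PADDED identities (π-cancellation, AyoubSpecialisation
stmt-0540 / route SpectatorSlicing, is not
a move), so the UNPADDED completion chain CompletionFiveR is open and is what tropical lifting
(sector fans ↦ toric changes of Schwinger
variables + additivity) predicts. What it does that other routes do not: LinRedNormalForm reaches
graph periods only VERTICALLY (K₄ ↦ an
MZV word representation, linearly reducible graphs only); this line is HORIZONTAL — graph-to-graph
identities certified by one change of
variables, valid beyond linear reducibility and beyond MZVs (the modular / K3 periods at 8 loops
obey completion and twist too) — and is
keyed to a decidable combinatorial invariant; no other open route touches Feynman periods; the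
negatives index (1 entry, KinematicFormulas
convexity) is not engaged.

RANKED CRUXES. #0 PhiFourKernelH (target) — KERNEL FORM OF THE ENLARGED CALCULUS KZ^H: every formal
ℤ-combination of integral representations with value 0 lies in the subgroup generated by domain
additivity, integrand additivity, change of variables, Newton–Leibniz AND the Hepp relator scheme
S_H = {[r₁] − [r₂]} over all pairs of φ⁴ edge lists E₁, E₂ (2kᵢ+2 edges on kᵢ+2 vertices, all
degrees ≤ 4) with parametric representations rᵢ (domain the open orthant of ℝ^(2kᵢ+1), integrand
1/Ψ_Eᵢ(x,1)² in determinantal form) and equal inlined Hepp bounds (Panzer2022 Prop. 3.2, unit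
indices: sum over flags γ₁ ⊊ ⋯ ⊊ γ_ℓ = Eᵢ of bridgeless edge sets with loops(γ_j) = j of
|γ₁|·Π|γ_(j+1)∖γ_j| / Π_(j<ℓ)(|γ_j| − 2j), bridgelessness and loop numbers via ℚ-ranks of incidence
matrices), written with the same literal body as TropicalLifting. Honest status: the summit ⇒ it
(KontsevichZagierPeriods ⇔ the kernel form `ker eval = relations` is PROVED in tree,
`kzKernelConjecture_iff_isRational`; then closure is monotone: support KernelOfSummitR, stated over
the summit constant, proved in Sketch.lean) and it ∧ TropicalLifting ⇒ the Statement (`closes`,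
proved) — so given the bet it is summit-EQUIVALENT (GPC-strength); it is filed so that the Hepp
relators are load-bearing in the deciding theorem and KZ^H ("rules 1)–3) plus 'Hepp-equal φ⁴ graphs
are interderivable' as an axiom scheme decidable on edge lists") is on record as a formal object.
Not a staffing target for provers; refuters reach it only through the summit-strength barriers. (why
it might fail: GPC-strength: false iff some null combination stays underivable even with every Hepp
relator adjoined — route Neg's candidates (regularised MZV relations, Gauss-multiplication pairs,
π-padding gaps) are untouched by φ⁴ relators.) [KontsevichZagier2001, HuberMullerStach2017,
Panzer2022, CressonViusos2022]
#2 PositionIsParametric (crux) — ENGINE of the dictionary (card P2; the refuter audit's "real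
crux"): for every edge list E on Fin (k+2), k ≥ 1 (vertex 0 ↦ origin, vertex 1 ↦ e₁, vertex j+2 ↦
y_j ∈ ℝ⁴), the affine position-space representation on ℝ^(4k) with integrand Π_e 1/|pt(E e).1 − pt(E
e).2|² (Schnetz2010 §2.2, §2.4; value π^(2k)·P(E)) is KZ-equivalent to the product representation on
ℝ^(2k) × (open orthant of ℝ^(2k+1)) with integrand Π_i 1/(1+t_i²) · 1/Ψ_E(x,1)² (value π^(2k)·P(E)).
Foreseen chain: Feynman parameters (rational Newton–Leibniz primitives: Beta integrals with integer
arguments) → complete squares (rational CoV) → fibrewise Cholesky-type scaling (ONE semialgebraic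
CoV; Jacobian an identity of rational functions by matrix-tree) → the unit ball of ℝ^(4k) sliced
into 2k disc factors [π] by algebraic fibrewise scalings → one rational Newton–Leibniz on the
compactified radial ray (the primitive of s^a/(s+m)^(a+3) is rational) → Cremona from the dual
polynomial Ψᶜ to Ψ. Planner's check of well-posedness: nailing ANY two vertices at 0 and e₁ gives
π^(2k)·∫Ω/Ψᶜ(α)² (the two-forest polynomial Φ₀₁ produced by the Gaussian step is removed by the
radial integration), so the item's choice of vertices 0, 1 is immaterial; for non-primitive E
neither side converges and the item is vacuous. [difficulty: XL] (why it might fail: π^(2k) must be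
PRODUCED by semialgebraic moves (ball ↦ disc slicings, rational radial primitive on a compactified
ray) and the fibrewise Gaussian/Cholesky step must be ONE semialgebraic CoV; a step truly needing an
arctan/log primitive re-opens the primitive barrier.) [Schnetz2010, BlochEsnaultKreimer2006,
KontsevichZagier2001, Brown2009FeynmanPeriods]
#3 CompletionFiveR (crux) — The smallest completion identity as an UNPADDED parametric
KZ-equivalence. The completed graph Γ = K₃,₄ + two edges inside the 4-set (= two K₅ = P₃ glued along
a triangle with the triangle removed, Schnetz2010 §2.5 product identity; period P₃² = 36ζ(3)²) has
two non-isomorphic decompletions: K₃,₃ + e (edges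
(0,3),(0,4),(0,5),(1,3),(1,4),(1,5),(2,3),(2,4),(2,5),(4,5)) and K₄ ⊕₂ K₄ (edges
(0,2),(0,3),(1,2),(1,3),(2,3),(0,4),(0,5),(1,4),(1,5),(4,5)); both parametric periods equal 36ζ(3)²
≈ 52.018 and both Hepp bounds equal 3528 (Panzer2022 Ex. 4.11; recomputed this session for both edge
lists), so [r₁] − [r₂] is a Hepp relator and the claim is the first interesting instance of
TropicalLifting: the two 9-dimensional representations ∫_(x>0) dx/Ψ(x,1)² are KZ-equivalent. Via
PositionIsParametric + CompletionIsInversion only the π⁸-PADDED versions are connected; an unpadded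
chain (a toric/Cremona-type birational correspondence between the two graph-hypersurface
complements, or the sector-by-sector correspondence TropicalLifting predicts) would be the first
parametric proof of a completion identity. [difficulty: L] (why it might fail: All known proofs of
completion run in position space (Panzer2022 §4) and certify only the π⁸-PADDED identity;
π-cancellation (stmt-0540) is not a move, so an unpadded chain may fail to exist although both
values are 36ζ(3)².) [Schnetz2010, Panzer2022, Brown2009FeynmanPeriods, BroadhurstKreimer1995]
#4 TropicalLifting (crux) — THE BET (card mechanism) = "S_H ⊆ KZ.relations": for φ⁴ edge lists E₁,
E₂ (degrees ≤ 4) with parametric representations r₁, r₂ (open orthants, integrands 1/Ψ_Eᵢ(x,1)²),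
equality of the inlined Hepp bounds H(E₁) = H(E₂) implies KZ.Equivalent r₁ r₂. By soundness it
contains Panzer's Conj. 1.2 (⇐); it contains every duality, completion, twist and Fourier(-split)
identity as an unpadded chain (H respects all five symmetries, Panzer2022 Thm 1.1) and the
unexplained pairs P(P₈,₃₀∖v) ≟ P(P₈,₃₆∖v), P(P₈,₃₁∖v) ≟ P(P₈,₃₅∖v) (Panzer2022 §5.2; PanzerYeats2025
(7.1)). Informal mechanism: an equality of Hepp bounds (for ℓ ≤ 11 the same classes as equal Martin
data M(G^[r]), PanzerYeats2025 Table 3) should come from a weight-preserving correspondence of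
bridgeless-flag sectors — a rational-PL scissors congruence of the two sector fans — which lifts
cone by cone to monomial changes of Schwinger variables plus domain/integrand additivity; the five
symmetries are the calibration (their Hepp proofs are the combinatorial shadows of the period
proofs, Panzer2022 §4). Degenerate edge lists are harmless: divergent ones admit no IntegralRep
(vacuous), disconnected ones give the identically-zero determinantal integrand (≡ 0 by one
integrand-additivity move) and Hepp bound 0. The restriction to φ⁴ is necessary: in 6-dimensional φ³
theory P₅,₅ and P₅,₉ share the Hepp bound with different periods (PanzerYeats2025 p. 70).
[difficulty: open-problem] (why it might fail: One rational number is far weaker than a sector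
correspondence: a Hepp-equal φ⁴ pair with certifiably different periods (none among >1000 exact
periods, ℓ ≤ 11; Balduf2023's complete ℓ ≤ 13 numerics not yet diffed against Hepp classes) kills
it; or periods agree but no chain exists.) [Panzer2022, PanzerYeats2025, PanzerSchnetz2017,
Balduf2023, Schnetz2010]
#5 PositionK4 (crux) — FIRST INSTANCE OF THE ENGINE (k = 2, E = K₄ = W₃, the smallest φ⁴ period; the
case k = 1 is vacuous because every 4-edge list on 3 vertices has a double edge and hence no
convergent representation): the position-space representation on ℝ⁸ (y₁ = (y0,…,y3), y₂ = (y4,…,y7)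
∈ ℝ⁴; vertices 0 ↦ origin, 1 ↦ e₁, the edge 01 contributing |e₁|⁻² = 1) with integrand
1/(|y₁|²·|y₂|²·|y₁−e₁|²·|y₂−e₁|²·|y₁−y₂|²), value π⁴·6ζ(3) (Schnetz2010 §2.4), is KZ-equivalent to
the product representation on ℝ⁴ × ℝ₊⁵ (coordinates z0…z3 free, z4…z8 > 0) with integrand Π_(i<4)
1/(1+z_i²) · 1/Ψ_K₄(z4,…,z8,1)², Ψ_K₄ written out as its 16 spanning-tree monomials for the edge
order 01,02,03,12,13,23 ↦ x₀,…,x₅ with x₅ = 1 (the determinantal form of PositionIsParametric at k =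
2, up to that finite identity). Foreseen chain: Feynman parameters, completing squares, two
fibrewise disc slicings turning the unit ball of ℝ⁸ into [π]⋆[π]⋆[π]⋆[π], one rational
Newton–Leibniz on the compactified radial ray, Cremona. [difficulty: L] (why it might fail: Same
engine risk in the smallest live dimension: π⁴ must be PRODUCED from the 8-ball by algebraic
fibrewise scalings and a rational radial primitive on a compactified ray; if the Feynman/Gaussian
step needs a non-semialgebraic fibrewise map already at k = 2, PositionIsParametric is dead.)
[Schnetz2010, BroadhurstKreimer1995, BlochEsnaultKreimer2006, KontsevichZagier2001]
#9 CompletionIsInversion (support) — Completion = conformal inversion (Schnetz2010 §2.3–2.4) as ONE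
change of variables: for an edge list of a graph on Fin 3 ⊕ Fin k with degree 4 at every free vertex
inr j and no loops, the position representations with roles (origin, e₁, ∞) = (inl 0, inl 1, inl 2)
and (inl 2, inl 1, inl 0) (edges at ∞ contribute 1) are KZ-equivalent: y_j ↦ y_j/|y_j|² on the
full-measure set Π(ℝ⁴∖0), Jacobian Π|y_j|^(−8), degree-4 bookkeeping swaps the roles of inl 0 and
inl 2. With PositionIsParametric this gives the π-PADDED completion invariance of parametric
representations. [difficulty: M] [Schnetz2010, BroadhurstKreimer1995]
#9 ProductK4K4 (support) — The 2-sum product identity, parametric (Brown2009FeynmanPeriods;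
Panzer2022 Prop. 4.10 is its Hepp shadow): the 9-dimensional representation of K₄ ⊕₂ K₄ (second edge
list of CompletionFiveR) is KZ-equivalent to the product representation on the orthant of ℝ¹⁰ with
integrand 1/Ψ_K₄(z₀…z₄,1)² · 1/Ψ_K₄(z₅…z₉,1)² (value (6ζ(3))²): Ψ = Ψ_(A∖e)Ψ_(B/f) + Ψ_(A/e)Ψ_(B∖f),
a scaling change of variables and one Beta integral with integer arguments (polynomial primitive).
[difficulty: M] [Brown2009FeynmanPeriods, Panzer2022, Schnetz2010]
#9 CremonaIsAMove (support) — Duality in the dictionary (Schnetz2010 §2.2 "Cremona transformation";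
BlochEsnaultKreimer2006; Panzer2022 §4): for ANY integrand shape p, ∫_(x>0) 1/p(x,1)² ~ ∫_(u>0)
1/((Π u)·p(1/u,1))² by the single change of variables u = 1/x on the open orthant (for p = Ψ_E the
right side is 1/Ψᶜ_E², the dual / planar-dual polynomial). [difficulty: provable-now]
[BlochEsnaultKreimer2006, Schnetz2010, Panzer2022]
#9 HeppK4 (support) — Calibration of the INLINED Hepp bound (certifies that the inline flag formula
is Panzer's): for K₄ (edges (0,1),(0,2),(0,3),(1,2),(1,3),(2,3)) the flag sum equals 84 = 12·6 + 6·2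
(Panzer2022 Ex. 3.3: 18 flags; reproduced this session by an independent script, which also returns
H(W₄) = 572 and H(W₅) = 13240/3 as in Prop. 3.19 and H(K₃,₃+e) = H(K₄⊕₂K₄) = 3528 as in Ex. 4.11).
[difficulty: M] [Panzer2022]
#9 KernelOfSummitR (support) — Honest-status lemma (route-repair 2026-08-15: supersedes
KernelOfSummit = stmt-KontsevichZagierPeriods-12295, `KZKernelConjecture → PhiFourKernelH`, dropped
because its hypothesis is the @[conjecture] decl KZKernelConjecture, which put an undeclared
conjecture into the route's cone; the new statement is keyed to the summit constant, logically
equivalent by the in-tree iff): the summit itself implies the target, KontsevichZagierPeriods →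
PhiFourKernelH (summit ⇔ kernel form in tree, `kzKernelConjecture_iff_isRational` /
`KontsevichZagierPeriods_iff`; then closure is monotone, `AddSubgroup.closure_mono
Set.subset_union_left`; 3-line proof in Sketch.lean, std axioms). Records the logical position of
KZ^H: given TropicalLifting, PhiFourKernelH ⇔ the summit (`closes` one way, KernelOfSummitR the
other) — the target overshoots nothing. [difficulty: provable-now] [KontsevichZagier2001,
HuberMullerStach2017]

TWO-LAYER PLAN. Foreseen glued splits (k ≤ 3, depth 1, filed only after a close):
PositionIsParametric ⇐ FeynmanParametersNL (Π 1/Q_e ~ (N−1)!·[Δ × ·, (Σα_eQ_e)^(−N)]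
by rational Newton–Leibniz) → GaussianToDeterminant (complete squares + fibrewise scaling; det = Ψᶜ
by matrix-tree) → BallToDiscs (unit ball of
ℝ^(4k) ~ rational·[π]^(⋆2k) by fibrewise disc scalings + a rational radial primitive) →
PositionIsParametric. CompletionFiveR ⇐ (padded chain:
PositionIsParametric k=4 + CompletionIsInversion) → (PiCancellation for this pair, shared with
AyoubSpecialisation stmt-0540 / SpectatorSlicing, OR an
unpadded sector correspondence found by search) → CompletionFiveR. TropicalLifting ⇐
SymmetryRelators (pairs related by the five operations) →
SporadicRelators (Hepp coincidences with no symmetry, first the two 8-loop pairs) — and, if a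
Hepp-equal pair with different Martin sequence and
different period ever appears, the restate MartinLifting keyed to PanzerYeats2025 Conj. 1.10.

KILL CRITERIA. TropicalLifting refuted by an explicit φ⁴ pair (equal Hepp bound, certified different
periods) ⇒ route BROKEN; ONE repair: add MartinLifting
(relators keyed to equal Martin sequences, PanzerYeats2025 Conj. 1.10) with a re-certified `closes`,
TropicalLifting kept as the negative edge;
refuted again ⇒ `close --reason refuted:TropicalLifting`. CompletionFiveR refuted (an additive
invariant FormalRep →+ A vanishing on the four
move sets and separating the two 5R representations) ⇒ refutes TropicalLifting AND, with 36ζ(3)² =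
36ζ(3)², the H21-literal summit: close
refuted and hand the witness to route Neg. PositionIsParametric / PositionK4 refuted (a step
provably needs a non-semialgebraic primitive or
fibre map) ⇒ pivot the laboratory to the parametric-only dictionary (CremonaIsAMove, ProductK4K4,
Fourier split) and record that position-space
QFT proofs lie outside the calculus (input to Neg and to SpectatorSlicing); the deciding chain is
unaffected. PhiFourKernelH is attackable only
through the summit-strength barriers. KZKernelConjecture proved elsewhere moots the route;
PiCancellation (stmt-0540) proved elsewhere turns every
padded chain of this route into an unpadded one (CompletionFiveR would follow from
PositionIsParametric + CompletionIsInversion).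

NOT DECOMPOSED YET. The informal crux HeppPair831 (parRep(P₈,₃₁∖v) ~ parRep(P₈,₃₅∖v); H = 536760
both, equal c₂, permanents and M(G^[r]) for r ≤ 8;
P(P₈,₃₁∖v) ≈ 460.09 exact in PanzerSchnetz2017, partner unknown) and its twin P₈,₃₀/P₈,₃₆ are filed
informal after open: the edge lists
live in ancillary files (PanzerSchnetz2017 Periods file; PanzerYeats2025 Martin4.txt), to be
set-signature'd in tenure. Not filed now: the
twist P₇,₄ ~ P₇,₇ and duality P₇,₅ ~ P₇,₁₀ instances (PanzerYeats2025 §7.1; one Cremona move resp. a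
position-space CoV — weak tests); the
Fourier split (Panzer's parametric proof should compile like ProductK4K4); W₃ = 6ζ(3) as a
derivation (belongs to LinRedNormalForm's
WheelThreeSpokes — shared support, not duplicated); π-cancellation as a statement (consequence of
the summit, owned by AyoubSpecialisation /
SpectatorSlicing); HeppForward (Conj. 1.2 ⇒, hypothesis-type, unprovable under the strength barrier
and no longer load-bearing in KZ^H);
Literature vocabulary (graphPeriodRep, kirchhoffPolynomial, heppBound, martinSequence) requested as
definitions — every inlined item is
restated verbatim over it once it lands; the index-refined Hepp function H(G,a) and the card's
uniform-in-a 'sliding polar' formulation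
(the rational function H(G,a) determines the spanning trees and hence the graph polynomial,
Panzer2022 Remark 2.3, so only special values
can be shared between non-isomorphic graphs; the lifting statement is kept at unit indices, exactly
where Conj. 1.2 lives).

CHEAPEST FALSIFIER. (i) DATA DIFF (refuters first; a kit/py job on public data): Balduf2023 computed
ALL φ⁴ periods for ℓ ≤ 13 numerically (relative accuracy
~10⁻³–10⁻⁴, §1.3, §3.4) and all Hepp bounds (§3.3, 'D.H.' = Hepp coincidences without known
symmetry); one Hepp-coincident pair whose periods
differ beyond the error bars kills TropicalLifting (no such pair is reported in Balduf2023 §3.3 or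
BaldufShaban2024 §7, but the diff is not
stated as performed either). (ii) Compute P(P₈,₃₅∖v) to 6 digits by tropical Monte Carlo (Borinsky's
algorithm, as used in Balduf2023) and
compare with P(P₈,₃₁∖v) = 460.0885…. (iii) For PositionK4: write the k = 2 chain by hand up to the
radial step — if the 8-ball ↦ [π]^(⋆4)
slicing or the Feynman-parameter Gaussian step needs a transcendental primitive, the engine is dead.
(iv) Look-up, done this session: Panzer2022
§5.2 and PanzerYeats2025 §7.1 report NO φ⁴ pair with equal Hepp bound and different known period (ℓ
≤ 11, > 1000 periods); the φ³ failure
(P₅,₅/P₅,₉, PanzerYeats2025 p. 70) is outside the item's degree-≤-4 hypothesis.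

NUMBERS. P(K₄) = 6ζ(3) ≈ 7.2123; H(K₄) = 84 (Panzer2022 Ex. 3.3; 18 flags, 12·6 + 6·2), H(W₄) = 572,
H(W₅) = 13240/3 (Prop. 3.19) — all three
reproduced this session by an independent flag-formula script; P(5R decompletions) = 36ζ(3)² ≈
52.018, H = 3528 for both edge lists of
CompletionFiveR (Ex. 4.11; reproduced); H(P₈,₃₀∖v) = H(P₈,₃₆∖v) = 1724488/3, H(P₈,₃₁∖v) = H(P₈,₃₅∖v)
= 536760, P(P₈,₃₁∖v) ≈ 460.09
(Panzer2022 p. 4, §5.2); irreducible φ⁴ graphs / Hepp classes: ℓ = 8: 41 / 29, ℓ = 9: 190 / 129, ℓ =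
10: 1182 / 776, ℓ = 11: 8687 / 6030
(PanzerYeats2025 Table 3, = Martin classes M(G^[2])); Balduf2023: all primitive completions with ℓ ≤
13 integrated numerically; Ψ_K₄(x,1)
has 16 monomials (8 cubic + 8 quadratic). Items at open: 11 (1 target, 4 cruxes, 5 support, 1
assembly).

DEFINITION REQUESTS. graphPeriodRep / kirchhoffPolynomial / positionRep
(Literature/MathematicalPhysics/QuantumFieldTheory: Schnetz2010 §2.2–2.4, BlochEsnaultKreimer2006;
convergence ⟺ primitive as a named fact, Schnetz2010 Prop. in §2.3); heppBound + HeppFaithful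
(Panzer2022 Def. 2.4, Prop. 3.2, Thm 1.1, Conj. 1.2)
and martinSequence + MartinFaithful (PanzerYeats2025 Def. 1.1, Conj. 1.10)
(Literature/Combinatorics/Matroid). Data want: edge lists of
P₈,₃₀, P₈,₃₁, P₈,₃₅, P₈,₃₆ (PanzerSchnetz2017 ancillary; PanzerYeats2025 Martin4.txt). Every inlined
item is restated over the vocabulary
once it lands; nothing in the deciding chain waits for it.

Novelty: Searches (2026-08-15, this session): `lit search --source arxiv "Martin invariants Feynman periods"`
(3: arXiv:2304.05299 = PanzerYeats2025,
arXiv:2305.13506 = Balduf2023, arXiv:2403.16217 = BaldufShaban2024); `lit search --source arxiv` ×5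
("Hepp bound tropical Feynman period
identity": 1 = arXiv:1908.09820; "parametric proof completion invariance Feynman period": 0;
"Kontsevich Zagier period conjecture Feynman graph
rules": 0; "tropical geometry scissors congruence period identity lifting": 0; "Brown Panzer Martin
invariant period point count": 0);
`--source zbmath "Martin invariant Feynman period" --year-from 2023` (3, the same three); `--source
crossref` (8, noise + doi:10.5070/c65165021);
OpenAlex / S2 HTTP 429 (logged); `lit galaxy search "Martin invariant" --star all` (0 hits); `lit
frontier KontsevichZagierPeriods --since 2020`
(30 descendants: MZV / GPC / log-corner items, none on graph periods); `lit bridges --cross any` (no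
QFT bridge); read in full text:
Panzer2022 §§1–5, PanzerYeats2025 §§1, 7, Balduf2023 §§1–3, BaldufShaban2024 §7, Schnetz2010 §2 —
plus the card's searches, route
PhiFourLaboratory's (same day) and refuter-novelty-7's audit (QFT side fully in print; rule-chains
and tropical lifting NOT in print).
Nearest prior art found: Panzer2022 = doi:10.4171/aihpd/126 (Hepp bound = tropical period, its five
symmetries, Conj. 1.2, the unexplained
8-loop pairs); PanzerYeats2025 = doi:10.5070/c65165021 (Martin sequence, Conj. 1.10, Table 3;
period-from-Martin an  [refs: 10.5070/c65165021, 10.4171/aihpd/126, 10.4310/cntp.2010.v4.n1.a1, 2304.05299, 2305.13506, 2403.16217, 1908.09820, doi:10.5070/c65165021, doi:10.4171/aihpd/126, doi:10.4310/cntp.2010.v4.n1.a1, PanzerYeats2025, Balduf2023, BaldufShaban2024, Panzer2022, Schnetz2010, BlochEsnaultKreimer2006]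

Barriers (technique_class: tropical-lifting, parametric-compilation, enlarged-kernel): - technique_class: tropical-lifting, parametric-compilation, enlarged-kernel
- Literature.Barriers.KontsevichZagierPeriods.noSemialgebraicPrimitive_inv_sub_two: ENGAGED by
PositionIsParametric / PositionK4 / ProductK4K4 and evaded by design — every Newton–Leibniz step
uses a RATIONAL primitive (Beta integrals with integer arguments; s^a/(s+m)^(a+3) has a rational
primitive) on a compactified ray, π is kept as [π] (disc) factors produced by algebraic fibrewise
scalings and never integrated, no hyperlogarithm is ever integrated (W₃ = 6ζ(3) is deliberately NOT
an item); the cruxes' why-might-fail lines name exactly where it could re-enter.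
- Literature.Barriers.KontsevichZagierPeriods.cressonViuSos_prop_3_2: not engaged — no global
volume-preserving PL/semialgebraic homeomorphism between two representations is sought; tropical
lifting is cone-by-cone (scissors: domain additivity + one monomial map per sector), CremonaIsAMove
/ CompletionIsInversion are single changes of variables on full-measure open cells with the null
complement handled by additivity.
- Literature.Barriers.KontsevichZagierPeriods.kzConjecture_implies_oddZetaAlgIndep: RESPECTED — this
sector is where the barrier lives (φ⁴ periods are ℚ-combinations of odd zetas and MZVs from 3 loops
on) and every relator asserts a derivation only between representations already known or conjectured
EQUAL; no independence of ζ(3), ζ(5), … is claimed; the strength sits openly in the target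
PhiFourKernelH (GPC-strength, not staffe

History (route lifecycle, newest last):
- 2026-08-15T21:16:16Z · rev 1: dropped KernelOfSummit — cone repair (route-repair planner): drop support KernelOfSummit (stmt-12295, KZKernelConjecture → PhiFourKernelH) — not load-bearing (closes : TropicalLifting → (planner-rrepair-KontsevichZagierPeriods-PhiFou-5f82b7ab-0)
- 2026-08-15T21:18:56Z · rev 2: dropped stmt-KontsevichZagierPeriods-12295 — route-repair (undeclared-conjecture, unit rconj-KontsevichZagierPeriods-PhiFour-5f82b7ab): the @[conjecture] decl Literature.NumberTheory.Transcendental.KZKerne (planner-rconj-KontsevichZagierPeriods-PhiFour-5f82b7ab-0)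
- 2026-08-16T04:09:27Z · AUTO-CRUX (backfill): PhiFourKernelH — hypotheses of the deciding theorem that nothing in the route derives are cruxes (operator:999:1085951)
- 2026-08-24T14:46:07Z · DORMANT — reconciler: no traction for 6.8 d (last activity item-evidence-added at 2026-08-17T18:10:27Z); parked, not closed — `ledger route dormant route-KontsevichZagier (operator:999:2070703)

sub-problem: KontsevichZagierPeriods · status: dormant · opened planner-plancard-KontsevichZagierPeriods-Kont-37c8eac3-g2-0 2026-08-15T18:52:12Z · rev 2 · ledger route-KontsevichZagierPeriods-PhiFourHepp
GENERATED by the gate from the ledger (D-0016/17). Provers cite these decls: `theorem foo : Summit.KontsevichZagierPeriods.KontsevichZagierPeriods.Theses.PhiFourHepp.<Decl> := …` in Summits/KontsevichZagierPeriods/KontsevichZagierPeriods/Theorems/<Name>.lean.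
-/

namespace Summit.KontsevichZagierPeriods.KontsevichZagierPeriods.Theses.PhiFourHepp

open scoped BigOperators Topology Manifold Classical MeasureTheory ProbabilityTheory Matrix InnerProductSpace ComplexConjugate ContinuousMap
open Filter Set Function TopologicalSpace MeasureTheory

attribute [summit_statement] _root_.KontsevichZagierPeriods

open Literature Periods

/-- item stmt-KontsevichZagierPeriods-12286 · crux (kind.auto-crux: conjecture-grade) · rank 0 · open · by planner
why it might fail: GPC-strength: false iff some null combination stays underivable even with every Hepp relator adjoined — route Neg's candidates (regularised MZV relations, Gauss-multiplication pairs, π-padding gaps) are untouched by φ⁴ relators.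
sources: KontsevichZagier2001, HuberMullerStach2017, Panzer2022, CressonViusos2022
[target] KERNEL FORM OF THE ENLARGED CALCULUS KZ^H: every formal ℤ-combination of integral
representations with value 0 lies in the subgroup generated by domain additivity, integrand
additivity, change of variables, Newton–Leibniz AND the Hepp relator scheme S_H = {[r₁] − [r₂]} over
all pairs of φ⁴ edge lists E₁, E₂ (2kᵢ+2 edges on kᵢ+2 vertices, all degrees ≤ 4) with parametric
representations rᵢ (domain the open orthant of ℝ^(2kᵢ+1), integrand 1/Ψ_Eᵢ(x,1)² in determinantal
form) and equal inlined Hepp bounds (Panzer2022 Prop. 3.2, unit indices: sum over flags γ₁ ⊊ ⋯ ⊊ γ_ℓ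
= Eᵢ of bridgeless edge sets with loops(γ_j) = j of |γ₁|·Π|γ_(j+1)∖γ_j| / Π_(j<ℓ)(|γ_j| − 2j),
bridgelessness and loop numbers via ℚ-ranks of incidence matrices), written with the same literal
body as TropicalLifting. Honest status: KZKernelConjecture ⇒ it trivially (closure is monotone:
support KernelOfSummit, proved in Sketch.lean) and it ∧ TropicalLifting ⇒ KZKernelConjecture ⇒ the
Statement (`closes`, proved) — so it is GPC-strength; it is filed so that the Hepp relators are
load-bearing in the deciding theorem and KZ^H ("rules 1)–3) plus 'Hepp-equal φ⁴ graphs are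
interderivable' as an axiom scheme decidable -/
@[route_item "route-KontsevichZagierPeriods-PhiFourHepp", crux]
def PhiFourKernelH : Prop :=
  ∀ c : Literature.NumberTheory.Transcendental.KZ.FormalRep, Literature.NumberTheory.Transcendental.KZ.eval c = 0 → c ∈ AddSubgroup.closure (Literature.NumberTheory.Transcendental.KZ.domainAddRel ∪ Literature.NumberTheory.Transcendental.KZ.integrandAddRel ∪ Literature.NumberTheory.Transcendental.KZ.changeOfVariablesRel ∪ Literature.NumberTheory.Transcendental.KZ.newtonLeibnizRel ∪ {d : Literature.NumberTheory.Transcendental.KZ.FormalRep | ∃ (k₁ k₂ : ℕ) (E₁ : Fin (2*k₁+2) → Fin (k₁+2) × Fin (k₁+2)) (E₂ : Fin (2*k₂+2) → Fin (k₂+2) × Fin (k₂+2)) (r₁ : Literature.NumberTheory.Transcendental.KZ.IntegralRep (2*k₁+1)) (r₂ : Literature.NumberTheory.Transcendental.KZ.IntegralRep (2*k₂+1)), (∀ v, (Finset.univ.filter fun e => (E₁ e).1 = v ∨ (E₁ e).2 = v).card ≤ 4) ∧ (∀ v, (Finset.univ.filter fun e => (E₂ e).1 = v ∨ (E₂ e).2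 = v).card ≤ 4) ∧ r₁.domain = {x | ∀ j, 0 < x j} ∧ Set.EqOn r₁.integrand (fun x => 1 / ((Matrix.fromBlocks (Matrix.diagonal (Fin.snoc x (1:ℝ) : Fin (2*k₁+2) → ℝ)) (Matrix.of fun (e : Fin (2*k₁+2)) (j : Fin (k₁+1)) => ((if (E₁ e).1 = j.succ then (1:ℝ) else 0) - (if (E₁ e).2 = j.succ then (1:ℝ) else 0))) (-(Matrix.of fun (e : Fin (2*k₁+2)) (j : Fin (k₁+1)) => ((if (E₁ e).1 = j.succ then (1:ℝ) else 0) - (if (E₁ e).2 = j.succ then (1:ℝ) else 0))).transpose) (0 : Matrix (Fin (k₁+1)) (Fin (k₁+1)) ℝ)).det) ^ 2) r₁.domain ∧ r₂.domain = {x | ∀ j, 0 < x j} ∧ Set.EqOn r₂.integrand (fun x => 1 / ((Matrix.fromBlocks (Matrix.diagonal (Fin.snoc x (1:ℝ) : Fin (2*k₂+2) → ℝ)) (Matrix.of fun (e : Fin (2*k₂+2)) (j : Fin (k₂+1)) => ((if (E₂ e).1 = j.succ then (1:ℝ) else 0) - (if (E₂ e).2 = j.succ then (1:ℝ) else 0)))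 (-(Matrix.of fun (e : Fin (2*k₂+2)) (j : Fin (k₂+1)) => ((if (E₂ e).1 = j.succ then (1:ℝ) else 0) - (if (E₂ e).2 = j.succ then (1:ℝ) else 0))).transpose) (0 : Matrix (Fin (k₂+1)) (Fin (k₂+1)) ℝ)).det) ^ 2) r₂.domain ∧ (∑ c : Fin (k₁+1) → Finset (Fin (2*k₁+2)), if ((∀ i : Fin (k₁+1), (c i).Nonempty ∧ (∀ e ∈ c i, (Matrix.of fun (p : {p // p ∈ (c i).erase e}) (v : Fin (k₁+2)) => ((if (E₁ p.1).1 = v then (1:ℚ) else 0) - (if (E₁ p.1).2 = v then (1:ℚ) else 0))).rank = (Matrix.of fun (p : {p // p ∈ c i}) (v : Fin (k₁+2)) => ((if (E₁ p.1).1 = v then (1:ℚ) else 0) - (if (E₁ p.1).2 = v then (1:ℚ) else 0))).rank) ∧ (c i).card - (Matrix.of fun (p : {p // p ∈ c i}) (v : Fin (k₁+2)) => ((if (E₁ p.1).1 = v then (1:ℚ) else 0) - (if (E₁ p.1).2 = v then (1:ℚ) else 0))).rank = i.val + 1) ∧ (∀ i j : Fin (k₁+1), i < j → c i ⊂ c j)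 ∧ c (Fin.last k₁) = Finset.univ) then ((c 0).card : ℚ) * (∏ i : Fin k₁, (((c i.succ).card : ℚ) - ((c i.castSucc).card : ℚ))) / (∏ i : Fin k₁, (((c i.castSucc).card : ℚ) - 2 * ((i.val : ℚ) + 1))) else 0) = (∑ c : Fin (k₂+1) → Finset (Fin (2*k₂+2)), if ((∀ i : Fin (k₂+1), (c i).Nonempty ∧ (∀ e ∈ c i, (Matrix.of fun (p : {p // p ∈ (c i).erase e}) (v : Fin (k₂+2)) => ((if (E₂ p.1).1 = v then (1:ℚ) else 0) - (if (E₂ p.1).2 = v then (1:ℚ) else 0))).rank = (Matrix.of fun (p : {p // p ∈ c i}) (v : Fin (k₂+2)) => ((if (E₂ p.1).1 = v then (1:ℚ) else 0) - (if (E₂ p.1).2 = v then (1:ℚ) else 0))).rank) ∧ (c i).card - (Matrix.of fun (p : {p // p ∈ c i}) (v : Fin (k₂+2)) => ((if (E₂ p.1).1 = v then (1:ℚ) else 0) - (if (E₂ p.1).2 = v then (1:ℚ) else 0))).rank = i.val + 1) ∧ (∀ i j : Fin (k₂+1), i < j → c i ⊂ c j) ∧ c (Fin.last k₂) = Finset.univ)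 then ((c 0).card : ℚ) * (∏ i : Fin k₂, (((c i.succ).card : ℚ) - ((c i.castSucc).card : ℚ))) / (∏ i : Fin k₂, (((c i.castSucc).card : ℚ) - 2 * ((i.val : ℚ) + 1))) else 0) ∧ d = Literature.NumberTheory.Transcendental.KZ.of r₁ - Literature.NumberTheory.Transcendental.KZ.of r₂})

/-- item stmt-KontsevichZagierPeriods-12287 · crux · rank 2 · open · by planner
why it might fail: π^(2k) must be PRODUCED by semialgebraic moves (ball ↦ disc slicings, rational radial primitive on a compactified ray) and the fibrewise Gaussian/Cholesky step must be ONE semialgebraic CoV; a step truly needing an arctan/log primitive re-opens the primitive barrier.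
sources: Schnetz2010, BlochEsnaultKreimer2006, KontsevichZagier2001, Brown2009FeynmanPeriods
[crux] ENGINE of the dictionary (card P2; the refuter audit's "real crux"): for every edge list E on
Fin (k+2), k ≥ 1 (vertex 0 ↦ origin, vertex 1 ↦ e₁, vertex j+2 ↦ y_j ∈ ℝ⁴), the affine
position-space representation on ℝ^(4k) with integrand Π_e 1/|pt(E e).1 − pt(E e).2|² (Schnetz2010
§2.2, §2.4; value π^(2k)·P(E)) is KZ-equivalent to the product representation on ℝ^(2k) × (open
orthant of ℝ^(2k+1)) with integrand Π_i 1/(1+t_i²) · 1/Ψ_E(x,1)² (value π^(2k)·P(E)). Foreseen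
chain: Feynman parameters (rational Newton–Leibniz primitives: Beta integrals with integer
arguments) → complete squares (rational CoV) → fibrewise Cholesky-type scaling (ONE semialgebraic
CoV; Jacobian an identity of rational functions by matrix-tree) → the unit ball of ℝ^(4k) sliced
into 2k disc factors [π] by algebraic fibrewise scalings → one rational Newton–Leibniz on the
compactified radial ray (the primitive of s^a/(s+m)^(a+3) is rational) → Cremona from the dual
polynomial Ψᶜ to Ψ. Planner's check of well-posedness: nailing ANY two vertices at 0 and e₁ gives
π^(2k)·∫Ω/Ψᶜ(α)² (the two-forest polynomial Φ₀₁ produced by the Gaussian step is removed by the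
radial integration), so the item's choice of vertices -/
@[route_item "route-KontsevichZagierPeriods-PhiFourHepp"]
def PositionIsParametric : Prop :=
  ∀ (k : ℕ), 1 ≤ k → ∀ (E : Fin (2*k+2) → Fin (k+2) × Fin (k+2)) (r : Literature.NumberTheory.Transcendental.KZ.IntegralRep (k*4)) (r' : Literature.NumberTheory.Transcendental.KZ.IntegralRep (2*k + (2*k+1))), r.domain = Set.univ → (∀ y, r.integrand y = ∏ e : Fin (2*k+2), 1 / (∑ i : Fin 4, ((Fin.cons (0 : Fin 4 → ℝ) (Fin.cons (fun i : Fin 4 => if i = 0 then (1:ℝ) else 0) (fun (j : Fin k) (i : Fin 4) => y (finProdFinEquiv (j, i)))) : Fin (k+2) → Fin 4 → ℝ) (E e).1 i - (Fin.cons (0 : Fin 4 → ℝ) (Fin.cons (fun i : Fin 4 => if i = 0 then (1:ℝ) else 0) (fun (j : Fin k) (i : Fin 4) => y (finProdFinEquiv (j, i)))) : Fin (k+2) → Fin 4 → ℝ) (E e).2 i) ^ 2)) → r'.domain = {z | ∀ j : Fin (2*k+1), 0 < z (Fin.natAdd (2*k) j)} → Set.EqOn r'.integrand (fun z => (∏ i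 : Fin (2*k), 1 / (1 + (z (Fin.castAdd (2*k+1) i)) ^ 2)) * (1 / ((Matrix.fromBlocks (Matrix.diagonal (Fin.snoc (fun j : Fin (2*k+1) => z (Fin.natAdd (2*k) j)) (1:ℝ) : Fin (2*k+2) → ℝ)) (Matrix.of fun (e : Fin (2*k+2)) (j : Fin (k+1)) => ((if (E e).1 = j.succ then (1:ℝ) else 0) - (if (E e).2 = j.succ then (1:ℝ) else 0))) (-(Matrix.of fun (e : Fin (2*k+2)) (j : Fin (k+1)) => ((if (E e).1 = j.succ then (1:ℝ) else 0) - (if (E e).2 = j.succ then (1:ℝ) else 0))).transpose) (0 : Matrix (Fin (k+1)) (Fin (k+1)) ℝ)).det) ^ 2)) r'.domain → Literature.NumberTheory.Transcendental.KZ.Equivalent r r'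

/-- item stmt-KontsevichZagierPeriods-12288 · crux · rank 3 · open · by planner
why it might fail: All known proofs of completion run in position space (Panzer2022 §4) and certify only the π⁸-PADDED identity; π-cancellation (stmt-0540) is not a move, so an unpadded chain may fail to exist although both values are 36ζ(3)².
sources: Schnetz2010, Panzer2022, Brown2009FeynmanPeriods, BroadhurstKreimer1995
[crux] The smallest completion identity as an UNPADDED parametric KZ-equivalence. The completed
graph Γ = K₃,₄ + two edges inside the 4-set (= two K₅ = P₃ glued along a triangle with the triangle
removed, Schnetz2010 §2.5 product identity; period P₃² = 36ζ(3)²) has two non-isomorphic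
decompletions: K₃,₃ + e (edges (0,3),(0,4),(0,5),(1,3),(1,4),(1,5),(2,3),(2,4),(2,5),(4,5)) and K₄
⊕₂ K₄ (edges (0,2),(0,3),(1,2),(1,3),(2,3),(0,4),(0,5),(1,4),(1,5),(4,5)); both parametric periods
equal 36ζ(3)² ≈ 52.018 and both Hepp bounds equal 3528 (Panzer2022 Ex. 4.11; recomputed this session
for both edge lists), so [r₁] − [r₂] is a Hepp relator and the claim is the first interesting
instance of TropicalLifting: the two 9-dimensional representations ∫_(x>0) dx/Ψ(x,1)² are
KZ-equivalent. Via PositionIsParametric + CompletionIsInversion only the π⁸-PADDED versions are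
connected; an unpadded chain (a toric/Cremona-type birational correspondence between the two
graph-hypersurface complements, or the sector-by-sector correspondence TropicalLifting predicts)
would be the first parametric proof of a completion identity. [difficulty: L] -/
@[route_item "route-KontsevichZagierPeriods-PhiFourHepp"]
def CompletionFiveR : Prop :=
  ∀ (r r' : Literature.NumberTheory.Transcendental.KZ.IntegralRep 9), r.domain = {x | ∀ j, 0 < x j} → Set.EqOn r.integrand (fun x => 1 / ((Matrix.fromBlocks (Matrix.diagonal (Fin.snoc x (1:ℝ) : Fin 10 → ℝ)) (Matrix.of fun (e : Fin 10) (j : Fin 5) => ((if ((![(0, 3), (0, 4), (0, 5), (1, 3), (1, 4), (1, 5), (2, 3), (2, 4), (2, 5), (4, 5)] : Fin 10 → Fin 6 × Fin 6) e).1 = j.succ then (1:ℝ) else 0) - (if ((![(0, 3), (0, 4), (0, 5), (1, 3), (1, 4), (1, 5), (2, 3), (2, 4), (2, 5), (4, 5)] : Fin 10 → Fin 6 × Fin 6) e).2 = j.succ then (1:ℝ) else 0))) (-(Matrix.of fun (e : Fin 10) (j : Fin 5) => ((if ((![(0, 3), (0, 4), (0, 5), (1, 3), (1, 4), (1, 5),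 (2, 3), (2, 4), (2, 5), (4, 5)] : Fin 10 → Fin 6 × Fin 6) e).1 = j.succ then (1:ℝ) else 0) - (if ((![(0, 3), (0, 4), (0, 5), (1, 3), (1, 4), (1, 5), (2, 3), (2, 4), (2, 5), (4, 5)] : Fin 10 → Fin 6 × Fin 6) e).2 = j.succ then (1:ℝ) else 0))).transpose) (0 : Matrix (Fin 5) (Fin 5) ℝ)).det) ^ 2) r.domain → r'.domain = {x | ∀ j, 0 < x j} → Set.EqOn r'.integrand (fun x => 1 / ((Matrix.fromBlocks (Matrix.diagonal (Fin.snoc x (1:ℝ) : Fin 10 → ℝ)) (Matrix.of fun (e : Fin 10) (j : Fin 5) => ((if ((![(0, 2), (0, 3), (1, 2), (1, 3), (2, 3), (0, 4), (0, 5), (1, 4), (1, 5), (4, 5)] : Fin 10 → Fin 6 × Fin 6) e).1 = j.succ then (1:ℝ) else 0) - (if ((![(0, 2), (0, 3), (1, 2), (1, 3), (2, 3), (0, 4), (0, 5), (1, 4), (1, 5), (4, 5)] : Fin 10 → Fin 6 × Fin 6) e).2 = j.succ then (1:ℝ) else 0))) (-(Matrix.of fun (e : Fin 10) (j : Fin 5)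 => ((if ((![(0, 2), (0, 3), (1, 2), (1, 3), (2, 3), (0, 4), (0, 5), (1, 4), (1, 5), (4, 5)] : Fin 10 → Fin 6 × Fin 6) e).1 = j.succ then (1:ℝ) else 0) - (if ((![(0, 2), (0, 3), (1, 2), (1, 3), (2, 3), (0, 4), (0, 5), (1, 4), (1, 5), (4, 5)] : Fin 10 → Fin 6 × Fin 6) e).2 = j.succ then (1:ℝ) else 0))).transpose) (0 : Matrix (Fin 5) (Fin 5) ℝ)).det) ^ 2) r'.domain → Literature.NumberTheory.Transcendental.KZ.Equivalent r r'

/-- item stmt-KontsevichZagierPeriods-12289 · crux · rank 4 · open · by planner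
why it might fail: One rational number is far weaker than a sector correspondence: a Hepp-equal φ⁴ pair with certifiably different periods (none among >1000 exact periods, ℓ ≤ 11; Balduf2023's complete ℓ ≤ 13 numerics not yet diffed against Hepp classes) kills it; or periods agree but no chain exists.
sources: Panzer2022, PanzerYeats2025, PanzerSchnetz2017, Balduf2023, Schnetz2010
[crux] THE BET (card mechanism) = "S_H ⊆ KZ.relations": for φ⁴ edge lists E₁, E₂ (degrees ≤ 4) with
parametric representations r₁, r₂ (open orthants, integrands 1/Ψ_Eᵢ(x,1)²), equality of the inlined
Hepp bounds H(E₁) = H(E₂) implies KZ.Equivalent r₁ r₂. By soundness it contains Panzer's Conj. 1.2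
(⇐); it contains every duality, completion, twist and Fourier(-split) identity as an unpadded chain
(H respects all five symmetries, Panzer2022 Thm 1.1) and the unexplained pairs P(P₈,₃₀∖v) ≟
P(P₈,₃₆∖v), P(P₈,₃₁∖v) ≟ P(P₈,₃₅∖v) (Panzer2022 §5.2; PanzerYeats2025 (7.1)). Informal mechanism: an
equality of Hepp bounds (for ℓ ≤ 11 the same classes as equal Martin data M(G^[r]), PanzerYeats2025
Table 3) should come from a weight-preserving correspondence of bridgeless-flag sectors — a
rational-PL scissors congruence of the two sector fans — which lifts cone by cone to monomial
changes of Schwinger variables plus domain/integrand additivity; the five symmetries are the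
calibration (their Hepp proofs are the combinatorial shadows of the period proofs, Panzer2022 §4).
Degenerate edge lists are harmless: divergent ones admit no IntegralRep (vacuous), disconnected ones
give the identically-zero det -/
@[route_item "route-KontsevichZagierPeriods-PhiFourHepp", crux]
def TropicalLifting : Prop :=
  ∀ (k₁ k₂ : ℕ) (E₁ : Fin (2*k₁+2) → Fin (k₁+2) × Fin (k₁+2)) (E₂ : Fin (2*k₂+2) → Fin (k₂+2) × Fin (k₂+2)), (∀ v, (Finset.univ.filter fun e => (E₁ e).1 = v ∨ (E₁ e).2 = v).card ≤ 4) → (∀ v, (Finset.univ.filter fun e => (E₂ e).1 = v ∨ (E₂ e).2 = v).card ≤ 4) → ∀ (r₁ : Literature.NumberTheory.Transcendental.KZ.IntegralRep (2*k₁+1)) (r₂ : Literature.NumberTheory.Transcendental.KZ.IntegralRep (2*k₂+1)), r₁.domain = {x | ∀ j, 0 < x j} → Set.EqOn r₁.integrand (fun x => 1 / ((Matrix.fromBlocks (Matrix.diagonal (Fin.snoc x (1:ℝ) : Fin (2*k₁+2) → ℝ)) (Matrix.of fun (e : Fin (2*k₁+2)) (j : Fin (k₁+1)) => ((if (E₁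 e).1 = j.succ then (1:ℝ) else 0) - (if (E₁ e).2 = j.succ then (1:ℝ) else 0))) (-(Matrix.of fun (e : Fin (2*k₁+2)) (j : Fin (k₁+1)) => ((if (E₁ e).1 = j.succ then (1:ℝ) else 0) - (if (E₁ e).2 = j.succ then (1:ℝ) else 0))).transpose) (0 : Matrix (Fin (k₁+1)) (Fin (k₁+1)) ℝ)).det) ^ 2) r₁.domain → r₂.domain = {x | ∀ j, 0 < x j} → Set.EqOn r₂.integrand (fun x => 1 / ((Matrix.fromBlocks (Matrix.diagonal (Fin.snoc x (1:ℝ) : Fin (2*k₂+2) → ℝ)) (Matrix.of fun (e : Fin (2*k₂+2)) (j : Fin (k₂+1)) => ((if (E₂ e).1 = j.succ then (1:ℝ) else 0) - (if (E₂ e).2 = j.succ then (1:ℝ) else 0))) (-(Matrix.of fun (e : Fin (2*k₂+2)) (j : Fin (k₂+1)) => ((if (E₂ e).1 = j.succ then (1:ℝ) else 0) - (if (E₂ e).2 = j.succ then (1:ℝ) else 0))).transpose) (0 : Matrix (Fin (k₂+1)) (Fin (k₂+1)) ℝ)).det) ^ 2) r₂.domain → (∑ c : Fin (k₁+1) → Finset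 (Fin (2*k₁+2)), if ((∀ i : Fin (k₁+1), (c i).Nonempty ∧ (∀ e ∈ c i, (Matrix.of fun (p : {p // p ∈ (c i).erase e}) (v : Fin (k₁+2)) => ((if (E₁ p.1).1 = v then (1:ℚ) else 0) - (if (E₁ p.1).2 = v then (1:ℚ) else 0))).rank = (Matrix.of fun (p : {p // p ∈ c i}) (v : Fin (k₁+2)) => ((if (E₁ p.1).1 = v then (1:ℚ) else 0) - (if (E₁ p.1).2 = v then (1:ℚ) else 0))).rank) ∧ (c i).card - (Matrix.of fun (p : {p // p ∈ c i}) (v : Fin (k₁+2)) => ((if (E₁ p.1).1 = v then (1:ℚ) else 0) - (if (E₁ p.1).2 = v then (1:ℚ) else 0))).rank = i.val + 1) ∧ (∀ i j : Fin (k₁+1), i < j → c i ⊂ c j) ∧ c (Fin.last k₁) = Finset.univ) then ((c 0).card : ℚ) * (∏ i : Fin k₁, (((c i.succ).card : ℚ) - ((c i.castSucc).card : ℚ))) / (∏ i : Fin k₁, (((c i.castSucc).card : ℚ) - 2 * ((i.val : ℚ) + 1))) else 0) = (∑ c : Fin (k₂+1) → Finset (Fin (2*k₂+2)), if ((∀ i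 : Fin (k₂+1), (c i).Nonempty ∧ (∀ e ∈ c i, (Matrix.of fun (p : {p // p ∈ (c i).erase e}) (v : Fin (k₂+2)) => ((if (E₂ p.1).1 = v then (1:ℚ) else 0) - (if (E₂ p.1).2 = v then (1:ℚ) else 0))).rank = (Matrix.of fun (p : {p // p ∈ c i}) (v : Fin (k₂+2)) => ((if (E₂ p.1).1 = v then (1:ℚ) else 0) - (if (E₂ p.1).2 = v then (1:ℚ) else 0))).rank) ∧ (c i).card - (Matrix.of fun (p : {p // p ∈ c i}) (v : Fin (k₂+2)) => ((if (E₂ p.1).1 = v then (1:ℚ) else 0) - (if (E₂ p.1).2 = v then (1:ℚ) else 0))).rank = i.val + 1) ∧ (∀ i j : Fin (k₂+1), i < j → c i ⊂ c j) ∧ c (Fin.last k₂) = Finset.univ) then ((c 0).card : ℚ) * (∏ i : Fin k₂, (((c i.succ).card : ℚ) - ((c i.castSucc).card : ℚ))) / (∏ i : Fin k₂, (((c i.castSucc).card : ℚ) - 2 * ((i.val : ℚ) + 1))) else 0) → Literature.NumberTheory.Transcendental.KZ.Equivalent r₁ r₂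

/-- item stmt-KontsevichZagierPeriods-12290 · crux · rank 5 · open · by planner
why it might fail: Same engine risk in the smallest live dimension: π⁴ must be PRODUCED from the 8-ball by algebraic fibrewise scalings and a rational radial primitive on a compactified ray; if the Feynman/Gaussian step needs a non-semialgebraic fibrewise map already at k = 2, PositionIsParametric is dead.
sources: Schnetz2010, BroadhurstKreimer1995, BlochEsnaultKreimer2006, KontsevichZagier2001
[crux] FIRST INSTANCE OF THE ENGINE (k = 2, E = K₄ = W₃, the smallest φ⁴ period; the case k = 1 is
vacuous because every 4-edge list on 3 vertices has a double edge and hence no convergent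
representation): the position-space representation on ℝ⁸ (y₁ = (y0,…,y3), y₂ = (y4,…,y7) ∈ ℝ⁴;
vertices 0 ↦ origin, 1 ↦ e₁, the edge 01 contributing |e₁|⁻² = 1) with integrand
1/(|y₁|²·|y₂|²·|y₁−e₁|²·|y₂−e₁|²·|y₁−y₂|²), value π⁴·6ζ(3) (Schnetz2010 §2.4), is KZ-equivalent to
the product representation on ℝ⁴ × ℝ₊⁵ (coordinates z0…z3 free, z4…z8 > 0) with integrand Π_(i<4)
1/(1+z_i²) · 1/Ψ_K₄(z4,…,z8,1)², Ψ_K₄ written out as its 16 spanning-tree monomials for the edge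
order 01,02,03,12,13,23 ↦ x₀,…,x₅ with x₅ = 1 (the determinantal form of PositionIsParametric at k =
2, up to that finite identity). Foreseen chain: Feynman parameters, completing squares, two
fibrewise disc slicings turning the unit ball of ℝ⁸ into [π]⋆[π]⋆[π]⋆[π], one rational
Newton–Leibniz on the compactified radial ray, Cremona. [difficulty: L] -/
@[route_item "route-KontsevichZagierPeriods-PhiFourHepp"]
def PositionK4 : Prop :=
  ∀ (r : Literature.NumberTheory.Transcendental.KZ.IntegralRep 8) (r' : Literature.NumberTheory.Transcendental.KZ.IntegralRep 9), r.domain = Set.univ → (∀ y, r.integrand y = 1 / ((y 0 ^ 2 + y 1 ^ 2 + y 2 ^ 2 + y 3 ^ 2) * (y 4 ^ 2 + y 5 ^ 2 + y 6 ^ 2 + y 7 ^ 2) * ((y 0 - 1) ^ 2 + y 1 ^ 2 + y 2 ^ 2 + y 3 ^ 2) * ((y 4 - 1) ^ 2 + y 5 ^ 2 + y 6 ^ 2 + y 7 ^ 2) * ((y 0 - y 4) ^ 2 + (y 1 - y 5) ^ 2 + (y 2 - y 6) ^ 2 + (y 3 - y 7) ^ 2))) → r'.domain = {z | 0 < z 4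 ∧ 0 < z 5 ∧ 0 < z 6 ∧ 0 < z 7 ∧ 0 < z 8} → Set.EqOn r'.integrand (fun z => 1 / ((1 + z 0 ^ 2) * (1 + z 1 ^ 2) * (1 + z 2 ^ 2) * (1 + z 3 ^ 2) * (z 4 * z 5 * z 7 + z 4 * z 5 * z 8 + z 4 * z 6 * z 7 + z 4 * z 6 * z 8 + z 5 * z 6 * z 7 + z 5 * z 6 * z 8 + z 5 * z 7 * z 8 + z 6 * z 7 * z 8 + z 4 * z 5 + z 4 * z 6 + z 4 * z 7 + z 4 * z 8 + z 5 * z 6 + z 5 * z 8 + z 6 * z 7 + z 7 * z 8) ^ 2)) r'.domain → Literature.NumberTheory.Transcendental.KZ.Equivalent r r'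

/-- item stmt-KontsevichZagierPeriods-13492 · support · rank 6 · open · by planner
[crux] OPEN INSTANCE WITH A PREDICTED ANSWER (Panzer2022 p. 4 and §5.2; PanzerYeats2025 §7.1 eq.
(7.1)): the parametric representations of the decompleted 8-loop φ⁴ graphs P₈,₃₁∖v and P₈,₃₅∖v
(Schnetz2010 census names; 16 edges on 9 vertices = k = 7 in the typing of TropicalLifting:
dimension 15, domain the open orthant, integrand 1/Ψ(x,1)² in determinantal form) are KZ.Equivalent.
Data: H(P₈,₃₁∖v) = H(P₈,₃₅∖v) = 536760; equal c₂ invariants, permanents and Martin data M(G^[r]) for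
r ≤ 8 (PanzerYeats2025 §7.1); P(P₈,₃₁∖v) ≈ 460.09 known exactly (PanzerSchnetz2017), P(P₈,₃₅∖v)
unknown; no product/duality/twist/completion/Fourier(-split) symmetry connects them ("the
combinatorial origin … is currently not understood", Panzer2022 p. 4; open question p. 43). A
literal instance of TropicalLifting and the sharpest test of the card's mechanism (a flag-sector
correspondence to be SEARCHED for, kit); its twin is P₈,₃₀∖v ~ P₈,₃₆∖v (H = 1724488/3). Signature to
be set (set-signature) once the edge lists are in hand (PanzerSchnetz2017 ancillary Periods file /
PanzerYeats2025 ancillary Martin4.txt; lit want acq-03769). WHY IT MIGHT FAIL: the two periods may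
simply differ — certified numerics (tr -/
@[route_item "route-KontsevichZagierPeriods-PhiFourHepp"]
def HeppPair831 : Prop :=
  ∀ (r r' : Literature.NumberTheory.Transcendental.KZ.IntegralRep 15), r.domain = {x | ∀ j, 0 < x j} → Set.EqOn r.integrand (fun x => 1 / ((Matrix.fromBlocks (Matrix.diagonal (Fin.snoc x (1:ℝ) : Fin 16 → ℝ)) (Matrix.of fun (e : Fin 16) (j : Fin 8) => ((if ((![(0, 1), (0, 2), (0, 3), (0, 4), (1, 2), (1, 3), (1, 8), (2, 5), (2, 6), (3, 7), (4, 5), (4, 6), (4, 7), (5, 8), (6, 8), (7, 8)] : Fin 16 → Fin 9 × Fin 9) e).1 = j.succ then (1:ℝ) else 0) - (if ((![(0, 1), (0, 2), (0, 3), (0, 4), (1, 2), (1, 3), (1, 8), (2, 5), (2, 6), (3, 7), (4, 5), (4, 6), (4, 7), (5, 8), (6, 8), (7, 8)] : Fin 16 → Fin 9 × Fin 9) e).2 = j.succ then (1:ℝ) else 0))) (-(Matrix.of fun (e : Fin 16) (j : Fin 8) => ((if ((![(0, 1), (0, 2), (0, 3), (0, 4), (1, 2), (1, 3), (1, 8),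 (2, 5), (2, 6), (3, 7), (4, 5), (4, 6), (4, 7), (5, 8), (6, 8), (7, 8)] : Fin 16 → Fin 9 × Fin 9) e).1 = j.succ then (1:ℝ) else 0) - (if ((![(0, 1), (0, 2), (0, 3), (0, 4), (1, 2), (1, 3), (1, 8), (2, 5), (2, 6), (3, 7), (4, 5), (4, 6), (4, 7), (5, 8), (6, 8), (7, 8)] : Fin 16 → Fin 9 × Fin 9) e).2 = j.succ then (1:ℝ) else 0))).transpose) (0 : Matrix (Fin 8) (Fin 8) ℝ)).det) ^ 2) r.domain → r'.domain = {x | ∀ j, 0 < x j} → Set.EqOn r'.integrand (fun x => 1 / ((Matrix.fromBlocks (Matrix.diagonal (Fin.snoc x (1:ℝ) : Fin 16 → ℝ)) (Matrix.of fun (e : Fin 16) (j : Fin 8) => ((if ((![(0, 1), (0, 2), (0, 3), (0, 4), (1, 2), (1, 5), (1, 8), (2, 6), (2, 7), (3, 4), (3, 5), (3, 7), (4, 6), (4, 8), (5, 6), (7, 8)] : Fin 16 → Fin 9 × Fin 9) e).1 = j.succ then (1:ℝ) else 0) - (if ((![(0, 1), (0, 2), (0, 3), (0, 4), (1, 2),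 (1, 5), (1, 8), (2, 6), (2, 7), (3, 4), (3, 5), (3, 7), (4, 6), (4, 8), (5, 6), (7, 8)] : Fin 16 → Fin 9 × Fin 9) e).2 = j.succ then (1:ℝ) else 0))) (-(Matrix.of fun (e : Fin 16) (j : Fin 8) => ((if ((![(0, 1), (0, 2), (0, 3), (0, 4), (1, 2), (1, 5), (1, 8), (2, 6), (2, 7), (3, 4), (3, 5), (3, 7), (4, 6), (4, 8), (5, 6), (7, 8)] : Fin 16 → Fin 9 × Fin 9) e).1 = j.succ then (1:ℝ) else 0) - (if ((![(0, 1), (0, 2), (0, 3), (0, 4), (1, 2), (1, 5), (1, 8), (2, 6), (2, 7), (3, 4), (3, 5), (3, 7), (4, 6), (4, 8), (5, 6), (7, 8)] : Fin 16 → Fin 9 × Fin 9) e).2 = j.succ then (1:ℝ) else 0))).transpose) (0 : Matrix (Fin 8) (Fin 8) ℝ)).det) ^ 2) r'.domain → Literature.NumberTheory.Transcendental.KZ.Equivalent r r'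

/-- item stmt-KontsevichZagierPeriods-12291 · support · rank 9 · open · by planner
sources: Schnetz2010, BroadhurstKreimer1995
[support] Completion = conformal inversion (Schnetz2010 §2.3–2.4) as ONE change of variables: for an
edge list of a graph on Fin 3 ⊕ Fin k with degree 4 at every free vertex inr j and no loops, the
position representations with roles (origin, e₁, ∞) = (inl 0, inl 1, inl 2) and (inl 2, inl 1, inl
0) (edges at ∞ contribute 1) are KZ-equivalent: y_j ↦ y_j/|y_j|² on the full-measure set Π(ℝ⁴∖0),
Jacobian Π|y_j|^(−8), degree-4 bookkeeping swaps the roles of inl 0 and inl 2. With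
PositionIsParametric this gives the π-PADDED completion invariance of parametric representations.
[difficulty: M] -/
@[route_item "route-KontsevichZagierPeriods-PhiFourHepp"]
def CompletionIsInversion : Prop :=
  ∀ (k : ℕ) (E : Fin (2*k+6) → (Fin 3 ⊕ Fin k) × (Fin 3 ⊕ Fin k)), (∀ j : Fin k, (Finset.univ.filter fun e => (E e).1 = Sum.inr j ∨ (E e).2 = Sum.inr j).card = 4) → (∀ e, (E e).1 ≠ (E e).2) → ∀ (r r' : Literature.NumberTheory.Transcendental.KZ.IntegralRep (k*4)), r.domain = Set.univ → (∀ y, r.integrand y = ∏ e : Fin (2*k+6), if (E e).1 = Sum.inl 2 ∨ (E e).2 = Sum.inl 2 then (1:ℝ) else 1 / (∑ i : Fin 4, ((Sum.elim ![(0 : Fin 4 → ℝ), (fun i : Fin 4 => if i = 0 then (1:ℝ) else 0), 0] (fun (j : Fin k) (i : Fin 4) => y (finProdFinEquiv (j, i)))) (E e).1 i - (Sum.elim ![(0 : Fin 4 → ℝ), (fun i : Fin 4 => if i = 0 then (1:ℝ) else 0), 0] (fun (j : Fin k) (i : Fin 4) => y (finProdFinEquiv (j, i)))) (E e).2 i)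 ^ 2)) → r'.domain = Set.univ → (∀ y, r'.integrand y = ∏ e : Fin (2*k+6), if (E e).1 = Sum.inl 0 ∨ (E e).2 = Sum.inl 0 then (1:ℝ) else 1 / (∑ i : Fin 4, ((Sum.elim ![(0 : Fin 4 → ℝ), (fun i : Fin 4 => if i = 0 then (1:ℝ) else 0), 0] (fun (j : Fin k) (i : Fin 4) => y (finProdFinEquiv (j, i)))) (E e).1 i - (Sum.elim ![(0 : Fin 4 → ℝ), (fun i : Fin 4 => if i = 0 then (1:ℝ) else 0), 0] (fun (j : Fin k) (i : Fin 4) => y (finProdFinEquiv (j, i)))) (E e).2 i) ^ 2)) → Literature.NumberTheory.Transcendental.KZ.Equivalent r r'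

/-- item stmt-KontsevichZagierPeriods-12292 · support · rank 9 · open · by planner
sources: Brown2009FeynmanPeriods, Panzer2022, Schnetz2010
[support] The 2-sum product identity, parametric (Brown2009FeynmanPeriods; Panzer2022 Prop. 4.10 is
its Hepp shadow): the 9-dimensional representation of K₄ ⊕₂ K₄ (second edge list of CompletionFiveR)
is KZ-equivalent to the product representation on the orthant of ℝ¹⁰ with integrand 1/Ψ_K₄(z₀…z₄,1)²
· 1/Ψ_K₄(z₅…z₉,1)² (value (6ζ(3))²): Ψ = Ψ_(A∖e)Ψ_(B/f) + Ψ_(A/e)Ψ_(B∖f), a scaling change of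
variables and one Beta integral with integer arguments (polynomial primitive). [difficulty: M] -/
@[route_item "route-KontsevichZagierPeriods-PhiFourHepp"]
def ProductK4K4 : Prop :=
  ∀ (r : Literature.NumberTheory.Transcendental.KZ.IntegralRep 9) (r' : Literature.NumberTheory.Transcendental.KZ.IntegralRep 10), r.domain = {x | ∀ j, 0 < x j} → Set.EqOn r.integrand (fun x => 1 / ((Matrix.fromBlocks (Matrix.diagonal (Fin.snoc x (1:ℝ) : Fin 10 → ℝ)) (Matrix.of fun (e : Fin 10) (j : Fin 5) => ((if ((![(0, 2), (0, 3), (1, 2), (1, 3), (2, 3), (0, 4), (0, 5), (1, 4), (1, 5), (4, 5)] : Fin 10 → Fin 6 × Fin 6) e).1 = j.succ then (1:ℝ) else 0) - (if ((![(0, 2), (0, 3), (1, 2), (1, 3), (2, 3), (0, 4), (0, 5), (1, 4), (1, 5), (4, 5)] : Fin 10 → Fin 6 × Fin 6) e).2 = j.succ then (1:ℝ) else 0))) (-(Matrix.of fun (e : Fin 10) (j : Fin 5) => ((if ((![(0, 2), (0, 3), (1, 2), (1, 3), (2, 3), (0, 4), (0, 5), (1, 4), (1, 5), (4, 5)] :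 Fin 10 → Fin 6 × Fin 6) e).1 = j.succ then (1:ℝ) else 0) - (if ((![(0, 2), (0, 3), (1, 2), (1, 3), (2, 3), (0, 4), (0, 5), (1, 4), (1, 5), (4, 5)] : Fin 10 → Fin 6 × Fin 6) e).2 = j.succ then (1:ℝ) else 0))).transpose) (0 : Matrix (Fin 5) (Fin 5) ℝ)).det) ^ 2) r.domain → r'.domain = {z | ∀ j, 0 < z j} → Set.EqOn r'.integrand (fun z => (1 / ((Matrix.fromBlocks (Matrix.diagonal (Fin.snoc (fun j : Fin 5 => z (Fin.castAdd 5 j)) (1:ℝ) : Fin 6 → ℝ)) (Matrix.of fun (e : Fin 6) (j : Fin 3) => ((if ((![(0, 1), (0, 2), (0, 3), (1, 2), (1, 3), (2, 3)] : Fin 6 → Fin 4 × Fin 4) e).1 = j.succ then (1:ℝ) else 0) - (if ((![(0, 1), (0, 2), (0, 3), (1, 2), (1, 3), (2, 3)] : Fin 6 → Fin 4 × Fin 4) e).2 = j.succ then (1:ℝ) else 0))) (-(Matrix.of fun (e : Fin 6) (j : Fin 3) => ((if ((![(0, 1), (0, 2), (0, 3), (1, 2), (1, 3), (2, 3)] :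 Fin 6 → Fin 4 × Fin 4) e).1 = j.succ then (1:ℝ) else 0) - (if ((![(0, 1), (0, 2), (0, 3), (1, 2), (1, 3), (2, 3)] : Fin 6 → Fin 4 × Fin 4) e).2 = j.succ then (1:ℝ) else 0))).transpose) (0 : Matrix (Fin 3) (Fin 3) ℝ)).det) ^ 2) * (1 / ((Matrix.fromBlocks (Matrix.diagonal (Fin.snoc (fun j : Fin 5 => z (Fin.natAdd 5 j)) (1:ℝ) : Fin 6 → ℝ)) (Matrix.of fun (e : Fin 6) (j : Fin 3) => ((if ((![(0, 1), (0, 2), (0, 3), (1, 2), (1, 3), (2, 3)] : Fin 6 → Fin 4 × Fin 4) e).1 = j.succ then (1:ℝ) else 0) - (if ((![(0, 1), (0, 2), (0, 3), (1, 2), (1, 3), (2, 3)] : Fin 6 → Fin 4 × Fin 4) e).2 = j.succ then (1:ℝ) else 0))) (-(Matrix.of fun (e : Fin 6) (j : Fin 3) => ((if ((![(0, 1), (0, 2), (0, 3), (1, 2), (1, 3), (2, 3)] : Fin 6 → Fin 4 × Fin 4) e).1 = j.succ then (1:ℝ) else 0) - (if ((![(0, 1), (0, 2), (0, 3), (1,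 2), (1, 3), (2, 3)] : Fin 6 → Fin 4 × Fin 4) e).2 = j.succ then (1:ℝ) else 0))).transpose) (0 : Matrix (Fin 3) (Fin 3) ℝ)).det) ^ 2)) r'.domain → Literature.NumberTheory.Transcendental.KZ.Equivalent r r'

/-- item stmt-KontsevichZagierPeriods-12293 · support · rank 9 · closed · proved by Summit.KontsevichZagierPeriods.PhiFourHepp.cremonaIsAMove_proof @ d607e6088f31 (prover) · by planner
sources: BlochEsnaultKreimer2006, Schnetz2010, Panzer2022
[support] Duality in the dictionary (Schnetz2010 §2.2 "Cremona transformation";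
BlochEsnaultKreimer2006; Panzer2022 §4): for ANY integrand shape p, ∫_(x>0) 1/p(x,1)² ~ ∫_(u>0)
1/((Π u)·p(1/u,1))² by the single change of variables u = 1/x on the open orthant (for p = Ψ_E the
right side is 1/Ψᶜ_E², the dual / planar-dual polynomial). [difficulty: provable-now] -/
@[route_item "route-KontsevichZagierPeriods-PhiFourHepp"]
def CremonaIsAMove : Prop :=
  ∀ (n : ℕ) (p : (Fin (n+1) → ℝ) → ℝ) (r r' : Literature.NumberTheory.Transcendental.KZ.IntegralRep n), r.domain = {x | ∀ j, 0 < x j} → Set.EqOn r.integrand (fun x => 1 / (p (Fin.snoc x 1)) ^ 2) r.domain → r'.domain = {u | ∀ j, 0 < u j} → Set.EqOn r'.integrand (fun u => 1 / ((∏ j, u j) * p (Fin.snoc (fun j => 1 / u j) 1)) ^ 2) r'.domain → Literature.NumberTheory.Transcendental.KZ.Equivalent r r'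

/-- item stmt-KontsevichZagierPeriods-12294 · support · rank 9 · open · by planner
sources: Panzer2022
[support] Calibration of the INLINED Hepp bound (certifies that the inline flag formula is
Panzer's): for K₄ (edges (0,1),(0,2),(0,3),(1,2),(1,3),(2,3)) the flag sum equals 84 = 12·6 + 6·2
(Panzer2022 Ex. 3.3: 18 flags; reproduced this session by an independent script, which also returns
H(W₄) = 572 and H(W₅) = 13240/3 as in Prop. 3.19 and H(K₃,₃+e) = H(K₄⊕₂K₄) = 3528 as in Ex. 4.11).
[difficulty: M] -/
@[route_item "route-KontsevichZagierPeriods-PhiFourHepp"]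
def HeppK4 : Prop :=
  (∑ c : Fin 3 → Finset (Fin 6), if ((∀ i : Fin 3, (c i).Nonempty ∧ (∀ e ∈ c i, (Matrix.of fun (p : {p // p ∈ (c i).erase e}) (v : Fin 4) => ((if ((![(0, 1), (0, 2), (0, 3), (1, 2), (1, 3), (2, 3)] : Fin 6 → Fin 4 × Fin 4) p.1).1 = v then (1:ℚ) else 0) - (if ((![(0, 1), (0, 2), (0, 3), (1, 2), (1, 3), (2, 3)] : Fin 6 → Fin 4 × Fin 4) p.1).2 = v then (1:ℚ) else 0))).rank = (Matrix.of fun (p : {p // p ∈ c i}) (v : Fin 4) => ((if ((![(0, 1), (0, 2), (0, 3), (1, 2), (1, 3), (2, 3)] : Fin 6 → Fin 4 × Fin 4) p.1).1 = v then (1:ℚ) else 0) - (if ((![(0, 1), (0, 2), (0, 3), (1, 2), (1, 3), (2, 3)] : Fin 6 → Fin 4 × Fin 4) p.1).2 = v then (1:ℚ) else 0))).rank) ∧ (c i).card - (Matrix.of fun (p : {p // p ∈ c i}) (v : Fin 4) => ((if ((![(0, 1), (0, 2), (0, 3), (1, 2), (1, 3), (2, 3)] : Fin 6 → Fin 4 ×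 Fin 4) p.1).1 = v then (1:ℚ) else 0) - (if ((![(0, 1), (0, 2), (0, 3), (1, 2), (1, 3), (2, 3)] : Fin 6 → Fin 4 × Fin 4) p.1).2 = v then (1:ℚ) else 0))).rank = i.val + 1) ∧ (∀ i j : Fin 3, i < j → c i ⊂ c j) ∧ c (Fin.last 2) = Finset.univ) then ((c 0).card : ℚ) * (∏ i : Fin 2, (((c i.succ).card : ℚ) - ((c i.castSucc).card : ℚ))) / (∏ i : Fin 2, (((c i.castSucc).card : ℚ) - 2 * ((i.val : ℚ) + 1))) else 0) = 84

/-- item stmt-KontsevichZagierPeriods-13814 · support · rank 9 · closed · proved by Summit.KontsevichZagierPeriods.PhiFourHepp.kernelOfSummitR_proof @ f9e000de57c3 (prover) · by planner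
sources: KontsevichZagier2001, HuberMullerStach2017
[support] Honest-status lemma (route-repair 2026-08-15: supersedes KernelOfSummit =
stmt-KontsevichZagierPeriods-12295, `KZKernelConjecture → PhiFourKernelH`, dropped because its
hypothesis is the @[conjecture] decl KZKernelConjecture, which put an undeclared conjecture into the
route's cone; this statement is keyed to the summit constant and is logically equivalent by the
in-tree iff): the summit itself implies the target, KontsevichZagierPeriods → PhiFourKernelH (summit
⇔ kernel form `ker eval = relations` proved in tree: `kzKernelConjecture_iff_isRational` /
`KontsevichZagierPeriods_iff`; then closure is monotone: `AddSubgroup.closure_mono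
Set.subset_union_left`; candidate proof `fun h c hc => AddSubgroup.closure_mono
Set.subset_union_left ((Literature.NumberTheory.Transcendental.kzKernelConjecture_iff_isRational.mpr
(KontsevichZagierPeriods_iff.mp h)) c hc)`, planner Sketch2.lean rc0, std axioms; needs `import
Literature.NumberTheory.Transcendental.KZKernelConjectureForms`). Records the logical position of
KZ^H: given TropicalLifting, PhiFourKernelH ⇔ the summit (`closes` one way, this item the other) —
the target overshoots nothing. [deps: PhiFourKernelH] [difficulty: provable -/
@[route_item "route-KontsevichZagierPeriods-PhiFourHepp"]
def KernelOfSummitR : Prop :=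
  _root_.KontsevichZagierPeriods → PhiFourKernelH

/-- item stmt-KontsevichZagierPeriods-12296 · assembly · rank 1 · closed · proved by Summit.KontsevichZagierPeriods.PhiFourHepp.assembly_proof @ af93d8e22ab1 (prover) · by planner
sources: KontsevichZagier2001, Panzer2022
[assembly] TropicalLifting → PhiFourKernelH → KontsevichZagierPeriods (the deciding theorem
`closes`; `assembly_holds : Assembly := closes` in Sketch.lean). -/
@[route_item "route-KontsevichZagierPeriods-PhiFourHepp"]
def Assembly : Prop :=
  TropicalLifting → PhiFourKernelH → _root_.KontsevichZagierPeriods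

/-! D-0027 §2.1 — DECIDING THEOREM (planner-authored via `route open/edit --closes-file`; by planner-plancard-KontsevichZagierPeriods-Kont-37c8eac3-g2-0 2026-08-15T18:52:13Z):
its hypotheses are this route's items and its conclusion the sub-problem Statement (glue_lint), and it elaborates with this file. -/

@[closes "route-KontsevichZagierPeriods-PhiFourHepp"] theorem closes (hT : TropicalLifting) (hK : PhiFourKernelH) : _root_.KontsevichZagierPeriods := by
  intro n m r r' _ _ hv
  refine (AddSubgroup.closure_le _).2 ?_
    (hK (Literature.NumberTheory.Transcendental.KZ.of r - Literature.NumberTheory.Transcendental.KZ.of r')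
      (by simp [Literature.NumberTheory.Transcendental.KZ.eval_of, hv]))
  refine Set.union_subset (Set.union_subset (Set.union_subset (Set.union_subset
    Literature.NumberTheory.Transcendental.KZ.domainAddRel_subset_relations
    Literature.NumberTheory.Transcendental.KZ.integrandAddRel_subset_relations)
    Literature.NumberTheory.Transcendental.KZ.changeOfVariablesRel_subset_relations)
    Literature.NumberTheory.Transcendental.KZ.newtonLeibnizRel_subset_relations) ?_
  rintro c ⟨k₁, k₂, E₁, E₂, r₁, r₂, hd₁, hd₂, hdom₁, hint₁, hdom₂, hint₂, hH, rfl⟩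
  exact hT k₁ k₂ E₁ E₂ hd₁ hd₂ r₁ r₂ hdom₁ hint₁ hdom₂ hint₂ hH

end Summit.KontsevichZagierPeriods.KontsevichZagierPeriods.Theses.PhiFourHepp
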